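import Mathlib.GroupTheory.Perm.Fin
import Mathlib.Algebra.BigOperators.Fin
import Mathlib.Data.Fintype.BigOperators
import Mathlib.Order.Interval.Finset.Fin
import Mathlib.Data.Fin.Tuple.Basic
import Mathlib.Data.Int.Order.Units
import Mathlib.Logic.Equiv.Fintype
import Mathlib.Algebra.MvPolynomial.Basic
import HarnessLib

/-!
# Latin rectangles, their column signs and patterns, Kumar's row-deletion lemma and the
# design polynomial whose multilinear coefficient is a sum of squares of signed counts
(Kumar 2015, §4 and Prop. 5.2 / Thm. 5.6)

Source: S. Kumar, *A study of the representations supported by the orbit closure of the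
determinant*, Compositio Math. 151 (2015) 292–312 = arXiv:1109.5996, §4 (Def. 4.1, Lemma 4.2,
Conj. 4.3, Prop. 4.4). This is the combinatorial input of Kumar's theorem (Bürgisser–Hüttenhain–
Ikenmeyer, Proc. AMS 145 (2017), Thm. 2: conditionally on the Alon–Tarsi conjecture, `n λ` occurs in
the coordinate ring of the orbit closure of `det_n` for every partition `λ` of length `≤ n`), whose
discharge is assembled in `Literature/Barriers/ValiantsHypothesis/NotViaSaturationsProofs.lean`.

Kumar, Def. 4.1: "By a Latin `(i,m)`-rectangle `A`, one means a `i × m` matrix … such that each row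
… is a permutation `σ_p` of `[m]` … and each column … consists of distinct numbers. We define the
sign `ε(A^q)` of `A^q` as follows: `ε(A^q) :=` sign of `∏_{1 ≤ p < p' ≤ i} (a^q_{p'} − a^q_p)`. Call a
Latin rectangle `A` column-even if `ε_c(A) := ∏_{q=1}^m ε(A^q)` is `+1` and column-odd otherwise.
Let `𝒜^q` denote the set `A^q` without regard to the order. Then, we call the `m`-tuple
`𝒜 = (𝒜^1, …, 𝒜^m)` the pattern of `A`. Let `L_𝒜` denote the set of Latin `(i,m)`-rectangles `A` with
pattern `𝒜`." Lemma 4.2: "Fix any `1 ≤ i ≤ m`. Assume that there exists a pattern `𝒜` of size `(i,m)`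
such that `♯L⁺_𝒜 ≠ ♯L⁻_𝒜`. Then, for any `1 ≤ i' ≤ i`, there exists a pattern `ℬ` of size `(i',m)`
such that `♯L⁺_ℬ ≠ ♯L⁻_ℬ`." (proof: remove the last row). Conj. 4.3 (column Latin square
conjecture, Huang–Rota): "`♯CELS(m) ≠ ♯COLS(m)`" for even `m`. Prop. 4.4: Conj. 4.3 for `m` gives,
for any `1 ≤ i ≤ m`, a pattern of size `(i,m)` with `♯L⁺_𝒜 ≠ ♯L⁻_𝒜`.

## Contents

* `seqSign g` — the sign of a sequence `g : Fin i → ι` into a linear order as the product over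
  pairs `p < p'` of `+1`/`-1` according as `g p < g p'` or not (Kumar's `ε(A^q)`); it is
  `Equiv.Perm.sign` on permutations of `Fin n` (`seqSign_coe_perm`, Mathlib's
  `Equiv.Perm.sign_eq_prod_prod_Ioi`), multiplicative under reordering of an injective sequence
  (`seqSign_comp_perm`, Mathlib's `Equiv.Perm.prod_Ioi_comp_eq_sign_mul_prod`), and drops its last
  entry by the factor `∏_{p < i} (±1)` (`seqSign_succ`).
* `IsLatinRect`, `rectColSign` (`ε_c`), `pattern`, `signedCount i m 𝒜 = ♯L⁺_𝒜 − ♯L⁻_𝒜`,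
  `latinColCount m = ♯CELS(m) − ♯COLS(m)` (Latin squares = Latin `(m,m)`-rectangles,
  `signedCount_self_univ`).
* `signedCount_succ_eq_zero` — the row-deletion step of Lemma 4.2 in contrapositive form (if all
  signed counts of size `(i,m)` vanish then so do all of size `(i+1,m)`): restricting to the first
  `i` rows is a bijection from `L_𝒜 ∩ {pattern of the first rows = ℬ}` onto `L_ℬ` along which the
  column sign changes by a constant (Kumar's (e15)).
* `exists_signedCount_ne_zero` — Lemma 4.2 / Prop. 4.4: `latinColCount m ≠ 0` gives, for every
  `i ≤ m`, a pattern of size `(i,m)` with nonzero signed count.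
* `designPoly i m ∈ ℤ[c_{r,a} : r < m, a < i]` — **the design polynomial**
  `∑_{σ : [m] → S_i} ∑_{π : [i] → S_m} sgn(σ) ∏_{p<i} ∏_{r<m} c_{r, σ_{π_p(r)}(p)}`. In the companion
  file `NotViaSaturationsProofs.lean` it is shown that `(m!)^{-i} · designPoly(c)` is the value of
  Kumar's highest-weight vector `P_i = γ_{m,i}` (the tree's hyperdeterminant polynomial
  `hyperdetPoly m t` on the top `i` letters) at the product of linear forms
  `∏_{r<m} ∑_{a<i} c_{r,a} x_{t a}` — Kumar's `θ(A)`, §3 — so that `P_i` does not vanish on the orbit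
  closure of `det_m` as soon as `designPoly i m ≠ 0` (Kumar Thm. 6.1).
* `coeff_allOnes_designPoly_eq_sum_sq` — **Kumar's Prop. 5.2 as a coefficient identity**: the
  coefficient of the multilinear monomial `∏_{r,a} c_{r,a}` in `designPoly i m` equals
  `∑_𝒜 (♯L⁺_𝒜 − ♯L⁻_𝒜)²`, the sum over all patterns of size `(i,m)` (Kumar:
  `⟨v_o^{⊗i}, S(B_o)·𝔳_o^{⊗i}⟩ = (1/m!)^i ∑_𝒜 (♯L⁺_𝒜 − ♯L⁻_𝒜)²`). Proof as in print: a term of the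
  design polynomial is multilinear iff for each `r` the letters `σ_{π_p r}(p)`, `p < i`, are
  distinct (`Good`); if some column of the array `N(p,j) = π_p⁻¹(j)` repeats an entry, composing the
  corresponding `σ_j` with the transposition is a sign-reversing involution (Kumar's (e18),
  `sum_sign_eq_zero_of_not_colInj`); otherwise `N` is a Latin rectangle and the good `σ` correspond
  bijectively to the Latin rectangles `K` with the pattern of `N`, with `sgn σ = ε_c(N) ε_c(K)`
  (`sum_sign_eq_of_colInj`); summing over `N` fibrewise by pattern gives the sum of squares.
* `designPoly_ne_zero_of_latinColCount_ne_zero` — hence (Lemma 4.2) `latinColCount m ≠ 0` forces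
  `designPoly i m ≠ 0` for all `i ≤ m` (the polynomial core of Kumar's Thm. 5.6 / Thm. 6.1).

Everything is over `Fin`, rows and columns indexed from `0`. No parity hypothesis on `m` is needed
for these statements (for odd `m ≥ 3` the hypothesis `latinColCount m ≠ 0` simply fails).

## References

* [Kumar2015] S. Kumar, Compositio Math. 151 (2015) 292–312, §4: Def. 4.1, Lemma 4.2, Conj. 4.3,
  Prop. 4.4, Rem. 4.5; §5: Prop. 5.2 (with (e18)), Cor. 5.3, Thm. 5.6; §3: Prop. 3.2; §6: Thm. 6.1.
* [HuangRota1994] R. Huang, G.-C. Rota, Discrete Math. 128 (1994) 225–236 (the column Latin square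
  conjecture and its equivalence with Alon–Tarsi, cited through Kumar Rem. 4.5).

## Mathlib

`Equiv.Perm.sign_eq_prod_prod_Ioi` and `Equiv.Perm.prod_Ioi_comp_eq_sign_mul_prod`
(`Mathlib.GroupTheory.Perm.Fin`) identify the inversion product with the signature; `Fin.init`,
`Fin.snoc`, `Finset.sum_fiberwise_of_maps_to`, `Finset.sum_nbij'`, `Finset.sum_ninvolution` do the
bookkeeping; `MvPolynomial.monomial_sum_index`, `coeff_monomial` read off the multilinear
coefficient. Mathlib has no Latin squares or rectangles.
-/

open Equiv Finset

namespace Literature.Computability.AlgebraicComplexity.Kumar2015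

/-! ### The sign of a sequence (Kumar's `ε(A^q)`) -/

section SeqSign

variable {ι : Type*} [LinearOrder ι] {i : ℕ}

/-- **The sign of a sequence** `g : Fin i → ι` (meaningful for injective `g`): the product over the
pairs `p < p'` of `+1` if `g p < g p'` and `-1` otherwise, i.e. `(-1)^{#inversions}` — Kumar's
"`ε(A^q) :=` sign of `∏_{1≤p<p'≤i} (a^q_{p'} - a^q_p)`". [cite: Kumar2015, Def. 4.1] -/
def seqSign (g : Fin i → ι) : ℤˣ :=
  ∏ p, ∏ p' ∈ Ioi p, if g p < g p' then 1 else -1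

/-- On a permutation of `Fin n` the sequence sign is the signature (Mathlib's
`Equiv.Perm.sign_eq_prod_prod_Ioi`). [folklore] -/
theorem seqSign_coe_perm {n : ℕ} (τ : Perm (Fin n)) : seqSign (⇑τ) = Perm.sign τ :=
  (Perm.sign_eq_prod_prod_Ioi τ).symm

/-- The antisymmetric integer comparison kernel `+1 / -1 / 0`. [folklore] -/
def cmpInt (a b : ι) : ℤ := if a < b then 1 else if b < a then -1 else 0

/-- `cmpInt` is antisymmetric. [folklore] -/
theorem cmpInt_antisymm (a b : ι) : cmpInt a b = -cmpInt b a := by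
  unfold cmpInt
  rcases lt_trichotomy a b with h | h | h
  · rw [if_pos h, if_neg (lt_asymm h), if_pos h]; norm_num
  · subst h; simp
  · rw [if_neg (lt_asymm h), if_pos h, if_pos h]

/-- For an injective sequence the sign, as an integer, is the product of the comparison kernels.
[folklore] -/
theorem coe_seqSign_of_injective {g : Fin i → ι} (hg : Function.Injective g) :
    ((seqSign g : ℤˣ) : ℤ) = ∏ p, ∏ p' ∈ Ioi p, cmpInt (g p) (g p') := by
  unfold seqSign
  push_cast
  refine Finset.prod_congr rfl fun p _ => Finset.prod_congr rfl fun p' hp' => ?_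
  have hne : g p ≠ g p' := fun h => (Finset.mem_Ioi.mp hp').ne (hg h)
  unfold cmpInt
  by_cases h : g p < g p'
  · simp [h]
  · have h' : g p' < g p := lt_of_le_of_ne (not_lt.mp h) (Ne.symm hne)
    simp [h, h']

/-- **Reordering an injective sequence multiplies its sign by the signature of the reordering**
(Mathlib's `Equiv.Perm.prod_Ioi_comp_eq_sign_mul_prod`). [folklore] -/
theorem seqSign_comp_perm {g : Fin i → ι} (hg : Function.Injective g) (τ : Perm (Fin i)) :
    seqSign (g ∘ τ) = Perm.sign τ * seqSign g := by
  apply Units.ext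
  rw [Units.val_mul, coe_seqSign_of_injective (hg.comp τ.injective), coe_seqSign_of_injective hg]
  exact Perm.prod_Ioi_comp_eq_sign_mul_prod τ (f := fun a b => cmpInt (g a) (g b))
    (fun a b => cmpInt_antisymm (g a) (g b))

/-- The sign as a product over all ordered pairs with an indicator. [folklore] -/
theorem seqSign_eq_prod_ite (g : Fin i → ι) :
    seqSign g = ∏ p, ∏ p', if p < p' then (if g p < g p' then 1 else -1 : ℤˣ) else 1 := by
  unfold seqSign
  refine Finset.prod_congr rfl fun p _ => ?_
  rw [← Finset.prod_filter, Finset.filter_lt_eq_Ioi]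

/-- **Deleting the last entry**: the sign of `g : Fin (i+1) → ι` is the sign of its first `i`
entries times `∏_{p<i} (±1)` according as `g p < g i` or not (the pairs involving the last
position). [cite: Kumar2015, Lemma 4.2 (proof, (e15))] -/
theorem seqSign_succ (g : Fin (i + 1) → ι) :
    seqSign g = seqSign (fun p : Fin i => g p.castSucc) *
      ∏ p : Fin i, (if g p.castSucc < g (Fin.last i) then 1 else -1 : ℤˣ) := by
  rw [seqSign_eq_prod_ite, seqSign_eq_prod_ite, Fin.prod_univ_castSucc]
  have hlast : (∏ p' : Fin (i + 1), if Fin.last i < p' then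
      (if g (Fin.last i) < g p' then 1 else -1 : ℤˣ) else 1) = 1 :=
    Finset.prod_eq_one fun p' _ => if_neg (not_lt.mpr (Fin.le_last p'))
  rw [hlast, mul_one, ← Finset.prod_mul_distrib]
  refine Finset.prod_congr rfl fun p _ => ?_
  rw [Fin.prod_univ_castSucc]
  simp only [Fin.castSucc_lt_castSucc_iff, Fin.castSucc_lt_last, if_true]

end SeqSign

/-! ### Latin rectangles, column signs, patterns and signed counts (Kumar Def. 4.1) -/

section LatinRect

variable {i m : ℕ}

/-- **Latin `(i,m)`-rectangles** (Kumar, Def. 4.1): `i × m` arrays over `Fin m` whose rows are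
permutations and whose columns have distinct entries. [cite: Kumar2015, Def. 4.1] -/
def IsLatinRect (R : Fin i → Fin m → Fin m) : Prop :=
  (∀ p, Function.Bijective (R p)) ∧ ∀ j, Function.Injective fun p => R p j

/-- **The column sign `ε_c(A) = ∏_q ε(A^q)`** of an array (Kumar, Def. 4.1).
[cite: Kumar2015, Def. 4.1] -/
def rectColSign (R : Fin i → Fin m → Fin m) : ℤˣ :=
  ∏ j, seqSign fun p => R p j

/-- **The pattern** of an array: the tuple of the sets of entries of its columns (Kumar, Def. 4.1:
"`𝒜^q` denote the set `A^q` without regard to the order"). [cite: Kumar2015, Def. 4.1] -/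
def pattern (R : Fin i → Fin m → Fin m) (j : Fin m) : Finset (Fin m) :=
  univ.image fun p => R p j

open Classical in
/-- **The signed count `♯L⁺_𝒜 − ♯L⁻_𝒜`** of the Latin `(i,m)`-rectangles with pattern `𝒜`
(Kumar, Def. 4.1, Lemma 4.2); `𝒜` ranges over all tuples of subsets, non-patterns counting `0`.
[cite: Kumar2015, Def. 4.1 and Lemma 4.2] -/
noncomputable def signedCount (i m : ℕ) (A : Fin m → Finset (Fin m)) : ℤ :=
  ∑ R ∈ (univ : Finset (Fin i → Fin m → Fin m)).filter (fun R => IsLatinRect R ∧ pattern R = A),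
    ((rectColSign R : ℤˣ) : ℤ)

open Classical in
/-- **The column-signed count of Latin squares `♯CELS(m) − ♯COLS(m)`** of Kumar's Conj. 4.3 (the
column Latin square conjecture of Huang–Rota asserts it is nonzero for even `m`), Latin squares being
the Latin `(m,m)`-rectangles. [cite: Kumar2015, Conj. 4.3] -/
noncomputable def latinColCount (m : ℕ) : ℤ :=
  ∑ R ∈ (univ : Finset (Fin m → Fin m → Fin m)).filter (fun R => IsLatinRect R),
    ((rectColSign R : ℤˣ) : ℤ)

/-- A square array with injective columns has the trivial pattern (Kumar: "for Latin
`(m,m)`-squares, there is a unique pattern: `([m], …, [m])`"). [cite: Kumar2015, Conj. 4.3 (remark following)] -/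
theorem pattern_eq_univ_of_injective {R : Fin m → Fin m → Fin m}
    (hR : ∀ j, Function.Injective fun p => R p j) : pattern R = fun _ => univ := by
  funext j
  exact Finset.image_univ_of_surjective (Finite.surjective_of_injective (hR j))

/-- The signed count of the trivial `(m,m)`-pattern is the column-signed count of Latin squares.
[cite: Kumar2015, Conj. 4.3 (remark following)] -/
theorem signedCount_self_univ (m : ℕ) : signedCount m m (fun _ => univ) = latinColCount m := by
  classical
  unfold signedCount latinColCount
  refine Finset.sum_congr ?_ fun _ _ => rfl
  ext R
  simp only [Finset.mem_filter, Finset.mem_univ, true_and]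
  exact ⟨fun h => h.1, fun h => ⟨h, pattern_eq_univ_of_injective h.2⟩⟩

/-! ### Deleting the last row (Kumar Lemma 4.2) -/

/-- The sign factor of the last row against the first `i` rows: `∏_j ∏_{p<i} (±1)` according as
`R p j < R i j` or not (Kumar's `ε(ℬ)` of (e15), before it is shown to depend on the patterns only).
[cite: Kumar2015, Lemma 4.2 (proof, (e15))] -/
def lastRowSign (R : Fin (i + 1) → Fin m → Fin m) : ℤˣ :=
  ∏ j, ∏ p : Fin i, (if R p.castSucc j < R (Fin.last i) j then 1 else -1 : ℤˣ)

/-- The column sign of an `(i+1) × m` array is that of its first `i` rows times the last-row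
factor. [cite: Kumar2015, Lemma 4.2 (proof, (e15))] -/
theorem rectColSign_succ (R : Fin (i + 1) → Fin m → Fin m) :
    rectColSign R = rectColSign (Fin.init R) * lastRowSign R := by
  unfold rectColSign lastRowSign
  rw [← Finset.prod_mul_distrib]
  refine Finset.prod_congr rfl fun j _ => ?_
  rw [seqSign_succ]
  rfl

/-- The pattern of an `(i+1) × m` array is obtained from the pattern of its first rows by inserting
the last row. [cite: Kumar2015, Lemma 4.2 (proof)] -/
theorem pattern_succ (R : Fin (i + 1) → Fin m → Fin m) (j : Fin m) :
    pattern R j = insert (R (Fin.last i) j) (pattern (Fin.init R) j) := by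
  ext x
  simp only [pattern, Finset.mem_image, Finset.mem_univ, true_and, Finset.mem_insert,
    Fin.exists_fin_succ']
  constructor
  · rintro (⟨p, hp⟩ | h)
    · exact Or.inr ⟨p, hp⟩
    · exact Or.inl h.symm
  · rintro (h | ⟨p, hp⟩)
    · exact Or.inr h.symm
    · exact Or.inl ⟨p, hp⟩

/-- In a Latin rectangle the last entry of a column is not among the earlier ones.
[cite: Kumar2015, Lemma 4.2 (proof)] -/
theorem last_not_mem_pattern_init {R : Fin (i + 1) → Fin m → Fin m} (hR : IsLatinRect R) (j : Fin m) :
    R (Fin.last i) j ∉ pattern (Fin.init R) j := by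
  simp only [pattern, Finset.mem_image, Finset.mem_univ, true_and, not_exists]
  intro p hp
  exact (Fin.castSucc_lt_last p).ne (hR.2 j hp)

/-- The first rows of a Latin rectangle form a Latin rectangle (Kumar: "removing the last row").
[cite: Kumar2015, Lemma 4.2 (proof)] -/
theorem isLatinRect_init {R : Fin (i + 1) → Fin m → Fin m} (hR : IsLatinRect R) :
    IsLatinRect (Fin.init R) :=
  ⟨fun p => hR.1 p.castSucc, fun j _ _ h => Fin.castSucc_injective _ (hR.2 j h)⟩

/-- The last row of a Latin rectangle is determined by its pattern and the pattern of its first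
rows (each last entry is the unique element of `𝒜_j ∖ ℬ_j`). [cite: Kumar2015, Lemma 4.2 (proof)] -/
theorem last_eq_of_patterns {R R₀ : Fin (i + 1) → Fin m → Fin m} (hR : IsLatinRect R)
    (hA : pattern R = pattern R₀)
    (hB : pattern (Fin.init R) = pattern (Fin.init R₀)) :
    R (Fin.last i) = R₀ (Fin.last i) := by
  funext j
  have h1 : R (Fin.last i) j ∈ pattern R₀ j := by
    rw [← hA, pattern_succ]
    exact Finset.mem_insert_self _ _
  rw [pattern_succ, Finset.mem_insert] at h1
  rcases h1 with h1 | h1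
  · exact h1
  · rw [← hB] at h1
    exact absurd h1 (last_not_mem_pattern_init hR j)

/-- **Kumar's (e15)**: on Latin rectangles with prescribed pattern and prescribed pattern of the
first rows, the last-row sign factor is constant. [cite: Kumar2015, Lemma 4.2 (proof, (e15))] -/
theorem lastRowSign_eq_of_patterns {R R₀ : Fin (i + 1) → Fin m → Fin m} (hR : IsLatinRect R)
    (hR₀ : IsLatinRect R₀) (hA : pattern R = pattern R₀)
    (hB : pattern (Fin.init R) = pattern (Fin.init R₀)) :
    lastRowSign R = lastRowSign R₀ := by
  have hlast := last_eq_of_patterns hR hA hB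
  have key : ∀ {S : Fin (i + 1) → Fin m → Fin m} (_ : IsLatinRect S) (j : Fin m),
      (∏ p : Fin i, (if S p.castSucc j < S (Fin.last i) j then 1 else -1 : ℤˣ)) =
        ∏ b ∈ pattern (Fin.init S) j, (if b < S (Fin.last i) j then 1 else -1 : ℤˣ) := by
    intro S hS j
    rw [pattern, Finset.prod_image fun x _ y _ h => (isLatinRect_init hS).2 j h]
    rfl
  unfold lastRowSign
  refine Finset.prod_congr rfl fun j _ => ?_
  rw [key hR, key hR₀, hB, hlast]

/-- Appending a row: a Latin `(i,m)`-rectangle extended by a permutation avoiding its columns is a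
Latin `(i+1,m)`-rectangle (the inverse of Kumar's row removal). [cite: Kumar2015, Lemma 4.2 (proof)] -/
theorem isLatinRect_snoc {R' : Fin i → Fin m → Fin m} (hR' : IsLatinRect R') {a : Fin m → Fin m}
    (ha : Function.Bijective a) (hnot : ∀ j, a j ∉ pattern R' j) :
    IsLatinRect (Fin.snoc R' a : Fin (i + 1) → Fin m → Fin m) := by
  refine ⟨fun p => ?_, fun j p q hpq => ?_⟩
  · refine Fin.lastCases ?_ (fun q => ?_) p
    · rw [Fin.snoc_last]; exact ha
    · rw [Fin.snoc_castSucc]; exact hR'.1 q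
  · revert hpq
    refine Fin.lastCases ?_ (fun p' => ?_) p <;> refine Fin.lastCases ?_ (fun q' => ?_) q
    · intro; rfl
    · intro h
      simp only [Fin.snoc_last, Fin.snoc_castSucc] at h
      exact absurd (Finset.mem_image.mpr ⟨q', Finset.mem_univ _, h.symm⟩) (hnot j)
    · intro h
      simp only [Fin.snoc_last, Fin.snoc_castSucc] at h
      exact absurd (Finset.mem_image.mpr ⟨p', Finset.mem_univ _, h⟩) (hnot j)
    · intro h
      simp only [Fin.snoc_castSucc] at h
      rw [hR'.2 j h]

/-- The pattern of an appended array. [cite: Kumar2015, Lemma 4.2 (proof)] -/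
theorem pattern_snoc (R' : Fin i → Fin m → Fin m) (a : Fin m → Fin m) (j : Fin m) :
    pattern (Fin.snoc R' a : Fin (i + 1) → Fin m → Fin m) j = insert (a j) (pattern R' j) := by
  rw [pattern_succ, Fin.snoc_last, Fin.init_snoc]

/-- **Row deletion (Kumar, Lemma 4.2, one step in contrapositive form).** If every pattern of size
`(i,m)` has signed count zero, then so has every pattern `𝒜` of size `(i+1,m)`: group `L_𝒜` by the
pattern `ℬ` of the first `i` rows; on each group the column sign is `ε(𝒜,ℬ) · ε_c(first rows)`
(`lastRowSign_eq_of_patterns`) and removing the last row is a bijection onto `L_ℬ` (its inverse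
appends the common last row), so the group contributes `ε(𝒜,ℬ) · (♯L⁺_ℬ − ♯L⁻_ℬ) = 0`.
[cite: Kumar2015, Lemma 4.2] -/
theorem signedCount_succ_eq_zero (h : ∀ B, signedCount i m B = 0) (A : Fin m → Finset (Fin m)) :
    signedCount (i + 1) m A = 0 := by
  classical
  unfold signedCount
  set F : Finset (Fin (i + 1) → Fin m → Fin m) :=
    univ.filter (fun R => IsLatinRect R ∧ pattern R = A) with hF
  rw [← Finset.sum_fiberwise_of_maps_to (s := F) (t := (univ : Finset (Fin m → Finset (Fin m))))
    (g := fun R => pattern (Fin.init R)) (fun _ _ => Finset.mem_univ _)]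
  refine Finset.sum_eq_zero fun B _ => ?_
  -- the fibre over `B`
  set G := F.filter (fun R => pattern (Fin.init R) = B) with hG
  rcases G.eq_empty_or_nonempty with hGe | ⟨R₀, hR₀⟩
  · rw [hGe, Finset.sum_empty]
  have hmemG : ∀ {R}, R ∈ G ↔ IsLatinRect R ∧ pattern R = A ∧ pattern (Fin.init R) = B := by
    intro R
    simp only [hG, hF, Finset.mem_filter, Finset.mem_univ, true_and, and_assoc]
  obtain ⟨hR₀L, hR₀A, hR₀B⟩ := hmemG.mp hR₀
  -- on the fibre, the sign factors as (a constant) · (sign of the first rows)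
  have hconst : ∀ R ∈ G, ((rectColSign R : ℤˣ) : ℤ) =
      ((lastRowSign R₀ : ℤˣ) : ℤ) * ((rectColSign (Fin.init R) : ℤˣ) : ℤ) := by
    intro R hR
    obtain ⟨hRL, hRA, hRB⟩ := hmemG.mp hR
    rw [rectColSign_succ, lastRowSign_eq_of_patterns hRL hR₀L (hRA.trans hR₀A.symm)
      (hRB.trans hR₀B.symm), Units.val_mul, mul_comm]
  rw [Finset.sum_congr rfl hconst, ← Finset.mul_sum]
  -- the first rows range over the Latin rectangles of pattern `B`
  set F' : Finset (Fin i → Fin m → Fin m) :=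
    univ.filter (fun R' => IsLatinRect R' ∧ pattern R' = B) with hF'
  have hsum : ∑ R ∈ G, ((rectColSign (Fin.init R) : ℤˣ) : ℤ) =
      ∑ R' ∈ F', ((rectColSign R' : ℤˣ) : ℤ) := by
    have ha₀ : ∀ j, R₀ (Fin.last i) j ∉ pattern (Fin.init R₀) j :=
      last_not_mem_pattern_init hR₀L
    refine Finset.sum_nbij' (fun R => Fin.init R)
      (fun R' => (Fin.snoc R' (R₀ (Fin.last i)) : Fin (i + 1) → Fin m → Fin m))
      (fun R hR => ?_) (fun R' hR' => ?_) (fun R hR => ?_) (fun R' _ => Fin.init_snoc _ _)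
      (fun _ _ => rfl)
    · obtain ⟨hRL, -, hRB⟩ := hmemG.mp hR
      simp only [hF', Finset.mem_filter, Finset.mem_univ, true_and]
      exact ⟨isLatinRect_init hRL, hRB⟩
    · simp only [hF', Finset.mem_filter, Finset.mem_univ, true_and] at hR'
      obtain ⟨hR'L, hR'B⟩ := hR'
      have hnot : ∀ j, R₀ (Fin.last i) j ∉ pattern R' j := fun j => by
        rw [hR'B, ← hR₀B]; exact ha₀ j
      refine hmemG.mpr ⟨isLatinRect_snoc hR'L (hR₀L.1 _) hnot, ?_, ?_⟩
      · funext j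
        rw [pattern_snoc, hR'B, ← hR₀B, ← pattern_succ, hR₀A]
      · rw [Fin.init_snoc, hR'B]
    · obtain ⟨hRL, hRA, hRB⟩ := hmemG.mp hR
      rw [← last_eq_of_patterns hRL (hRA.trans hR₀A.symm) (hRB.trans hR₀B.symm)]
      exact Fin.snoc_init_self _
  rw [hsum]
  change ((lastRowSign R₀ : ℤˣ) : ℤ) * signedCount i m B = 0
  rw [h B, mul_zero]

/-- **Kumar, Lemma 4.2 / Prop. 4.4.** If the column-signed count of Latin squares of order `m`
is nonzero (the conclusion of the column Latin square conjecture for `m`), then for every `i ≤ m`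
some pattern of size `(i,m)` has `♯L⁺_𝒜 ≠ ♯L⁻_𝒜`: iterate the row deletion down from the unique
pattern of size `(m,m)`. [cite: Kumar2015, Lemma 4.2 and Prop. 4.4] -/
theorem exists_signedCount_ne_zero (hm : latinColCount m ≠ 0) (hi : i ≤ m) :
    ∃ A, signedCount i m A ≠ 0 := by
  by_contra hcon
  push Not at hcon
  have step : ∀ d, ∀ A, signedCount (i + d) m A = 0 := by
    intro d
    induction d with
    | zero => simpa using hcon
    | succ d ih => exact fun A => signedCount_succ_eq_zero ih A
  have := step (m - i) (fun _ => univ)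
  rw [Nat.add_sub_cancel' hi, signedCount_self_univ] at this
  exact hm this

end LatinRect

/-! ### The design polynomial and its multilinear coefficient (Kumar Prop. 5.2, Thm. 5.6) -/

section Design

open MvPolynomial

variable {i m : ℕ}

/-- **The design polynomial** `∑_{σ : [m] → S_i} ∑_{π : [i] → S_m} sgn(σ) ∏_{p,r} c_{r, σ_{π_p r}(p)}`
in the `m · i` variables `c_{r,a}` over `ℤ`: up to the factor `(m!)^{-i}`, the value of Kumar's
highest-weight vector `P_i` at the product of the linear forms `L_r = ∑_a c_{r,a} x_a` (Kumar's map
`θ : M(m,i) → 𝒫^m(E_i)`, §3, composed with `P_i`; the identification is proved in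
`NotViaSaturationsProofs.lean`). [cite: Kumar2015, §3 (θ) and Prop. 3.2] -/
noncomputable def designPoly (i m : ℕ) : MvPolynomial (Fin m × Fin i) ℤ :=
  ∑ σ : Fin m → Perm (Fin i), ∑ π : Fin i → Perm (Fin m),
    C ((∏ j, Perm.sign (σ j) : ℤˣ) : ℤ) * ∏ p : Fin i, ∏ r : Fin m, X (r, σ (π p r) p)

/-- The exponent vector of the `(σ, π)` term of the design polynomial. [folklore] -/
noncomputable def designExp (σ : Fin m → Perm (Fin i)) (π : Fin i → Perm (Fin m)) :
    (Fin m × Fin i) →₀ ℕ :=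
  ∑ p : Fin i, ∑ r : Fin m, Finsupp.single (r, σ (π p r) p) 1

/-- The all-ones exponent vector: the multilinear monomial `∏_{r,a} c_{r,a}`. [folklore] -/
noncomputable def allOnes (i m : ℕ) : (Fin m × Fin i) →₀ ℕ :=
  Finsupp.equivFunOnFinite.symm fun _ => 1

/-- Every entry of `allOnes` is `1`. [folklore] -/
@[simp] theorem allOnes_apply (x : Fin m × Fin i) : allOnes i m x = 1 := by
  simp [allOnes]

/-- The monomial of the `(σ, π)` term. [folklore] -/
theorem prod_prod_X_eq_monomial (σ : Fin m → Perm (Fin i)) (π : Fin i → Perm (Fin m)) :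
    (∏ p : Fin i, ∏ r : Fin m, X (r, σ (π p r) p) : MvPolynomial (Fin m × Fin i) ℤ) =
      monomial (designExp σ π) 1 := by
  rw [designExp, monomial_sum_index, C_1, one_mul]
  refine Finset.prod_congr rfl fun p _ => ?_
  rw [monomial_sum_index, C_1, one_mul]
  rfl

/-- The exponent of `c_{r,a}` in the `(σ, π)` term counts the rows `p` whose `r`-th form carries the
letter `a`. [folklore] -/
theorem designExp_apply (σ : Fin m → Perm (Fin i)) (π : Fin i → Perm (Fin m)) (r : Fin m)
    (a : Fin i) : designExp σ π (r, a) = (univ.filter fun p => σ (π p r) p = a).card := by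
  classical
  rw [designExp, Finsupp.coe_finsetSum, Finset.sum_apply]
  simp only [Finsupp.coe_finsetSum, Finset.sum_apply, Finsupp.single_apply, Prod.mk.injEq]
  rw [Finset.card_eq_sum_ones, Finset.sum_filter]
  refine Finset.sum_congr rfl fun p _ => ?_
  rw [Finset.sum_eq_single r]
  · simp
  · intro r' _ hr'
    rw [if_neg fun h => hr' h.1]
  · exact fun h => absurd (Finset.mem_univ r) h

/-- A map from a finite type is bijective iff all its fibres are singletons. [folklore] -/
theorem bijective_iff_card_filter_eq_one {α β : Type*} [Fintype α] [DecidableEq β] (f : α → β) :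
    (∀ b, (univ.filter fun a => f a = b).card = 1) ↔ Function.Bijective f := by
  constructor
  · intro h
    refine ⟨fun a a' haa' => ?_, fun b => ?_⟩
    · obtain ⟨a₀, ha₀⟩ := Finset.card_eq_one.mp (h (f a))
      have ha : a ∈ ({a₀} : Finset α) := ha₀ ▸ Finset.mem_filter.mpr ⟨Finset.mem_univ _, rfl⟩
      have ha' : a' ∈ ({a₀} : Finset α) :=
        ha₀ ▸ Finset.mem_filter.mpr ⟨Finset.mem_univ _, haa'.symm⟩
      rw [Finset.mem_singleton] at ha ha'
      rw [ha, ha']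
    · obtain ⟨a₀, ha₀⟩ := Finset.card_eq_one.mp (h b)
      have : a₀ ∈ univ.filter fun a => f a = b := ha₀ ▸ Finset.mem_singleton_self _
      exact ⟨a₀, (Finset.mem_filter.mp this).2⟩
  · intro hf b
    rw [Finset.card_eq_one]
    obtain ⟨a, rfl⟩ := hf.2 b
    refine ⟨a, Finset.ext fun a' => ?_⟩
    simp only [Finset.mem_filter, Finset.mem_univ, true_and, Finset.mem_singleton]
    exact hf.1.eq_iff

/-- **The good terms**: for each linear form `r`, the letters `σ_{π_p r}(p)` attached to it in the
rows `p < i` are distinct (Kumar: the summands of `⟨v_o^{⊗i}, S(B_o) 𝔳_o^{⊗i}⟩` with nonzero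
pairing). [cite: Kumar2015, Prop. 5.2 (proof)] -/
def Good (σ : Fin m → Perm (Fin i)) (π : Fin i → Perm (Fin m)) : Prop :=
  ∀ r : Fin m, Function.Injective fun p : Fin i => σ (π p r) p

/-- A term of the design polynomial is multilinear iff it is good. [cite: Kumar2015, Prop. 5.2 (proof)] -/
theorem designExp_eq_allOnes_iff (σ : Fin m → Perm (Fin i)) (π : Fin i → Perm (Fin m)) :
    designExp σ π = allOnes i m ↔ Good σ π := by
  classical
  constructor
  · intro h r
    have hb : Function.Bijective fun p : Fin i => σ (π p r) p :=
      (bijective_iff_card_filter_eq_one _).mp fun a => by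
        rw [← designExp_apply, h, allOnes_apply]
    exact hb.1
  · intro h
    ext ⟨r, a⟩
    rw [designExp_apply, allOnes_apply]
    exact (bijective_iff_card_filter_eq_one _).mpr (Finite.injective_iff_bijective.mp (h r)) a

open Classical in
/-- **The multilinear coefficient of the design polynomial** is the signed count of its good terms.
[cite: Kumar2015, Prop. 5.2 (proof)] -/
theorem coeff_allOnes_designPoly (i m : ℕ) :
    coeff (allOnes i m) (designPoly i m) =
      ∑ π : Fin i → Perm (Fin m), ∑ σ : Fin m → Perm (Fin i),
        if Good σ π then ((∏ j, Perm.sign (σ j) : ℤˣ) : ℤ) else 0 := by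
  classical
  rw [designPoly, coeff_sum]
  simp_rw [coeff_sum]
  rw [Finset.sum_comm]
  refine Finset.sum_congr rfl fun π _ => Finset.sum_congr rfl fun σ _ => ?_
  rw [prod_prod_X_eq_monomial, coeff_C_mul, coeff_monomial]
  by_cases h : Good σ π
  · rw [if_pos ((designExp_eq_allOnes_iff σ π).mpr h), if_pos h, mul_one]
  · rw [if_neg (fun h' => h ((designExp_eq_allOnes_iff σ π).mp h')), if_neg h, mul_zero]

/-! #### Cancellation: arrays `π` with a repeated column entry contribute nothing (Kumar (e18)) -/

/-- The array attached to `π` (Kumar's `A(σ)`/`R`): row `p` is the inverse of the permutation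
`π_p`, so that its rows are permutations of `[m]`. [cite: Kumar2015, Prop. 5.2 (proof, A(σ))] -/
def rowsOf (π : Fin i → Perm (Fin m)) : Fin i → Fin m → Fin m := fun p j => (π p).symm j

/-- Column injectivity of `rowsOf π`, i.e. `rowsOf π` is a Latin `(i,m)`-rectangle.
[cite: Kumar2015, Prop. 5.2 (proof, the set R′)] -/
def ColInj (π : Fin i → Perm (Fin m)) : Prop := ∀ j, Function.Injective fun p => (π p).symm j

open Classical in
/-- **Kumar's cancellation (e18).** If some column of `rowsOf π` repeats an entry (say in rows
`p₀ ≠ p₁` of column `j₀`), then `σ ↦ σ[j₀ ↦ σ_{j₀} ∘ (p₀ p₁)]` is an involution on the `σ`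
preserving goodness (it reorders the letters of one linear form) and reversing `sgn σ`, so the good
`σ` contribute zero in total. [cite: Kumar2015, Prop. 5.2 (proof, (e18))] -/
theorem sum_sign_eq_zero_of_not_colInj {π : Fin i → Perm (Fin m)} (hπ : ¬ ColInj π) :
    (∑ σ : Fin m → Perm (Fin i), if Good σ π then ((∏ j, Perm.sign (σ j) : ℤˣ) : ℤ) else 0) = 0 := by
  classical
  -- a repeated entry in a column
  simp only [ColInj, not_forall] at hπ
  obtain ⟨j₀, hj₀⟩ := hπ
  rw [Function.Injective] at hj₀
  push Not at hj₀
  obtain ⟨p₀, p₁, hp, hne⟩ := hj₀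
  set r₀ : Fin m := (π p₀).symm j₀ with hr₀
  have hπ₀ : π p₀ r₀ = j₀ := by rw [hr₀]; exact Equiv.apply_symm_apply _ _
  have hπ₁ : π p₁ r₀ = j₀ := by rw [hp]; exact Equiv.apply_symm_apply _ _
  -- the involution
  let g : (Fin m → Perm (Fin i)) → (Fin m → Perm (Fin i)) := fun σ =>
    Function.update σ j₀ (σ j₀ * swap p₀ p₁)
  have hg_apply : ∀ σ j p, g σ j p = σ j (if j = j₀ then swap p₀ p₁ p else p) := by
    intro σ j p
    by_cases hj : j = j₀
    · subst hj; simp [g]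
    · simp [g, hj]
  have hgg : ∀ σ, g (g σ) = σ := by
    intro σ
    funext j
    by_cases hj : j = j₀
    · subst hj
      simp only [g, Function.update_self, mul_assoc, swap_mul_self, mul_one]
    · simp [g, hj]
  have hsign : ∀ σ, ((∏ j, Perm.sign (g σ j) : ℤˣ) : ℤ) = -((∏ j, Perm.sign (σ j) : ℤˣ) : ℤ) := by
    intro σ
    rw [← Finset.mul_prod_erase _ _ (Finset.mem_univ j₀),
      ← Finset.mul_prod_erase _ _ (Finset.mem_univ j₀)]
    have h1 : ∏ j ∈ univ.erase j₀, Perm.sign (g σ j) = ∏ j ∈ univ.erase j₀, Perm.sign (σ j) :=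
      Finset.prod_congr rfl fun j hj => by
        rw [Finset.mem_erase] at hj
        simp [g, hj.1]
    rw [h1]
    simp only [g, Function.update_self, Perm.sign_mul, Perm.sign_swap hne]
    push_cast
    ring
  -- `Good` is invariant: the letter maps are precomposed with a permutation
  have hletters : ∀ σ r, (fun p => g σ (π p r) p) =
      (fun p => σ (π p r) p) ∘ ⇑(if r = r₀ then swap p₀ p₁ else (1 : Perm (Fin i))) := by
    intro σ r
    funext p
    simp only [Function.comp_apply]
    rw [hg_apply]
    by_cases hr : r = r₀
    · subst hr
      rw [if_pos rfl]
      by_cases h0 : p = p₀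
      · rw [h0, swap_apply_left, hπ₀, hπ₁, if_pos rfl]
      · by_cases h1 : p = p₁
        · rw [h1, swap_apply_right, hπ₀, hπ₁, if_pos rfl]
        · rw [swap_apply_of_ne_of_ne h0 h1]
          split_ifs <;> rfl
    · rw [if_neg hr, Perm.coe_one, id_eq]
      by_cases hj : π p r = j₀
      · have h0 : p ≠ p₀ := by
          rintro rfl; exact hr ((π p).injective (hj.trans hπ₀.symm))
        have h1 : p ≠ p₁ := by
          rintro rfl; exact hr ((π p).injective (hj.trans hπ₁.symm))
        rw [if_pos hj, swap_apply_of_ne_of_ne h0 h1]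
      · rw [if_neg hj]
  have hgood : ∀ σ, Good (g σ) π ↔ Good σ π := by
    intro σ
    simp only [Good]
    refine forall_congr' fun r => ?_
    rw [hletters σ r]
    exact Equiv.injective_comp _ _
  -- pair off `σ` with `g σ`
  refine Finset.sum_ninvolution g (fun σ => ?_) (fun σ hσ => ?_) (fun σ => Finset.mem_univ _) hgg
  · by_cases h : Good σ π
    · rw [if_pos h, if_pos ((hgood σ).mpr h), hsign]; ring
    · rw [if_neg h, if_neg (fun h' => h ((hgood σ).mp h')), add_zero]
  · -- `g σ ≠ σ`
    intro hEq
    have := congrFun (congrArg (fun τ : Fin m → Perm (Fin i) => ⇑(τ j₀)) hEq) p₀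
    simp only [g, Function.update_self, Perm.coe_mul, Function.comp_apply, swap_apply_left] at this
    exact hne ((σ j₀).injective this).symm

/-! #### Latin-rectangle arrays: good `σ` ↔ Latin rectangles with the same pattern -/

/-- For column-injective `π`, `rowsOf π` is a Latin rectangle. [cite: Kumar2015, Prop. 5.2 (proof)] -/
theorem isLatinRect_rowsOf {π : Fin i → Perm (Fin m)} (hπ : ColInj π) : IsLatinRect (rowsOf π) :=
  ⟨fun p => (π p).symm.bijective, hπ⟩

/-- **The second Latin rectangle** attached to a good `σ` (Kumar's `B ∈ L_{𝒜}` in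
`∑_{B ∈ L_𝒜} ε_c(B) V_B`): row `a`, column `j` holds the entry of `rowsOf π` in column `j` at the
row `p` with `σ_j(p) = a`. [cite: Kumar2015, Prop. 5.2 (proof)] -/
def kOf (π : Fin i → Perm (Fin m)) (σ : Fin m → Perm (Fin i)) : Fin i → Fin m → Fin m :=
  fun a j => (π ((σ j).symm a)).symm j

/-- `kOf` in the row `σ_j p`. [cite: Kumar2015, Prop. 5.2 (proof)] -/
theorem kOf_apply_sigma (π : Fin i → Perm (Fin m)) (σ : Fin m → Perm (Fin i)) (p : Fin i)
    (j : Fin m) : kOf π σ (σ j p) j = rowsOf π p j := by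
  simp [kOf, rowsOf]

/-- Column `j` of `rowsOf π` is column `j` of `kOf π σ` reordered by `σ_j`.
[cite: Kumar2015, Prop. 5.2 (proof)] -/
theorem col_rowsOf_eq_comp (π : Fin i → Perm (Fin m)) (σ : Fin m → Perm (Fin i)) (j : Fin m) :
    (fun p => rowsOf π p j) = (fun a => kOf π σ a j) ∘ ⇑(σ j) := by
  funext p
  exact (kOf_apply_sigma π σ p j).symm

/-- `σ` is good iff the rows of `kOf π σ` have distinct entries. [cite: Kumar2015, Prop. 5.2 (proof)] -/
theorem good_iff_rows_kOf_injective (π : Fin i → Perm (Fin m)) (σ : Fin m → Perm (Fin i)) :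
    Good σ π ↔ ∀ a, Function.Injective (kOf π σ a) := by
  constructor
  · intro h a j j' hjj'
    simp only [kOf] at hjj'
    set p := (σ j).symm a with hp
    set p' := (σ j').symm a with hp'
    set r := (π p).symm j with hr
    have h1 : π p r = j := by rw [hr]; exact Equiv.apply_symm_apply _ _
    have h2 : π p' r = j' := by rw [hjj']; exact Equiv.apply_symm_apply _ _
    have h3 : σ (π p r) p = σ (π p' r) p' := by
      rw [h1, h2, hp, hp', Equiv.apply_symm_apply, Equiv.apply_symm_apply]
    have hpp' : p = p' := h r h3
    rw [← h1, ← h2, hpp']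
  · intro h r p p' hpp'
    dsimp only at hpp'
    set j := π p r with hj
    set j' := π p' r with hj'
    have h1 : kOf π σ (σ j p) j = r := by
      rw [kOf_apply_sigma, rowsOf, hj, Equiv.symm_apply_apply]
    have h2 : kOf π σ (σ j' p') j' = r := by
      rw [kOf_apply_sigma, rowsOf, hj', Equiv.symm_apply_apply]
    rw [hpp'] at h1
    have hjj : j = j' := h _ (h1.trans h2.symm)
    have : σ j p = σ j p' := hpp'.trans (by rw [← hjj])
    exact (σ j).injective this

/-- For column-injective `π` and good `σ`, `kOf π σ` is a Latin rectangle.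
[cite: Kumar2015, Prop. 5.2 (proof)] -/
theorem isLatinRect_kOf {π : Fin i → Perm (Fin m)} (hπ : ColInj π) {σ : Fin m → Perm (Fin i)}
    (hσ : Good σ π) : IsLatinRect (kOf π σ) := by
  refine ⟨fun a => Finite.injective_iff_bijective.mp ((good_iff_rows_kOf_injective π σ).mp hσ a),
    fun j => ?_⟩
  change Function.Injective ((fun p => rowsOf π p j) ∘ ⇑(σ j).symm)
  rw [Equiv.injective_comp]
  exact hπ j

/-- `kOf π σ` has the pattern of `rowsOf π`. [cite: Kumar2015, Prop. 5.2 (proof)] -/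
theorem pattern_kOf (π : Fin i → Perm (Fin m)) (σ : Fin m → Perm (Fin i)) :
    pattern (kOf π σ) = pattern (rowsOf π) := by
  funext j
  ext x
  simp only [pattern, Finset.mem_image, Finset.mem_univ, true_and]
  constructor
  · rintro ⟨a, rfl⟩
    exact ⟨(σ j).symm a, by simp [kOf, rowsOf]⟩
  · rintro ⟨p, rfl⟩
    exact ⟨σ j p, kOf_apply_sigma π σ p j⟩

/-- **The sign identity `sgn σ = ε_c(rowsOf π) · ε_c(kOf π σ)`** (column by column,
`seqSign_comp_perm`). [cite: Kumar2015, Prop. 5.2 (proof)] -/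
theorem prod_sign_eq {π : Fin i → Perm (Fin m)} (hπ : ColInj π) {σ : Fin m → Perm (Fin i)}
    (hσ : Good σ π) : (∏ j, Perm.sign (σ j)) = rectColSign (rowsOf π) * rectColSign (kOf π σ) := by
  rw [rectColSign, rectColSign, ← Finset.prod_mul_distrib]
  refine Finset.prod_congr rfl fun j _ => ?_
  have hK : Function.Injective fun a => kOf π σ a j := (isLatinRect_kOf hπ hσ).2 j
  have h := seqSign_comp_perm hK (σ j)
  rw [← col_rowsOf_eq_comp] at h
  rw [h, mul_assoc, Int.units_mul_self, mul_one]

/-- The inverse construction: the row of `K` carrying, in column `j`, the entry of `rowsOf π` at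
`(p, j)` (junk value `p` if there is none). [cite: Kumar2015, Prop. 5.2 (proof)] -/
noncomputable def invColAt (π : Fin i → Perm (Fin m)) (K : Fin i → Fin m → Fin m) (j : Fin m)
    (p : Fin i) : Fin i :=
  if h : ∃ a, K a j = rowsOf π p j then Classical.choose h else p

/-- Specification of `invColAt`. [cite: Kumar2015, Prop. 5.2 (proof)] -/
theorem kOf_invColAt {π : Fin i → Perm (Fin m)} {K : Fin i → Fin m → Fin m} {j : Fin m}
    {p : Fin i} (h : ∃ a, K a j = rowsOf π p j) : K (invColAt π K j p) j = rowsOf π p j := by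
  rw [invColAt, dif_pos h]
  exact Classical.choose_spec h

/-- With the pattern of `rowsOf π`, every entry of `rowsOf π` occurs in the same column of `K`.
[cite: Kumar2015, Prop. 5.2 (proof)] -/
theorem exists_of_pattern_eq {π : Fin i → Perm (Fin m)} {K : Fin i → Fin m → Fin m}
    (hK : pattern K = pattern (rowsOf π)) (j : Fin m) (p : Fin i) :
    ∃ a, K a j = rowsOf π p j := by
  have : rowsOf π p j ∈ pattern K j := by
    rw [hK]; exact Finset.mem_image.mpr ⟨p, Finset.mem_univ _, rfl⟩
  obtain ⟨a, -, ha⟩ := Finset.mem_image.mp this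
  exact ⟨a, ha⟩

/-- `invColAt π K j` is injective when `π` is column-injective and `K` has the right pattern.
[cite: Kumar2015, Prop. 5.2 (proof)] -/
theorem invColAt_injective {π : Fin i → Perm (Fin m)} (hπ : ColInj π) {K : Fin i → Fin m → Fin m}
    (hK : pattern K = pattern (rowsOf π)) (j : Fin m) : Function.Injective (invColAt π K j) := by
  intro p p' h
  have h1 := kOf_invColAt (exists_of_pattern_eq hK j p)
  have h2 := kOf_invColAt (exists_of_pattern_eq hK j p')
  rw [h] at h1
  exact hπ j (h1.symm.trans h2)

/-- The permutations `σ_j = K_j⁻¹ ∘ (rowsOf π)_j` attached to a Latin rectangle `K` with the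
pattern of `rowsOf π` (junk value `1` off this locus). [cite: Kumar2015, Prop. 5.2 (proof)] -/
noncomputable def sigmaOf (π : Fin i → Perm (Fin m)) (K : Fin i → Fin m → Fin m) :
    Fin m → Perm (Fin i) := fun j =>
  if h : Function.Injective (invColAt π K j) then
    Equiv.ofBijective _ (Finite.injective_iff_bijective.mp h) else 1

/-- `sigmaOf` on the good locus. [cite: Kumar2015, Prop. 5.2 (proof)] -/
theorem sigmaOf_apply {π : Fin i → Perm (Fin m)} (hπ : ColInj π) {K : Fin i → Fin m → Fin m}
    (hK : pattern K = pattern (rowsOf π)) (j : Fin m) (p : Fin i) :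
    sigmaOf π K j p = invColAt π K j p := by
  rw [sigmaOf, dif_pos (invColAt_injective hπ hK j)]
  rfl

/-- `kOf ∘ sigmaOf = id` on Latin rectangles with the pattern of `rowsOf π`.
[cite: Kumar2015, Prop. 5.2 (proof)] -/
theorem kOf_sigmaOf {π : Fin i → Perm (Fin m)} (hπ : ColInj π) {K : Fin i → Fin m → Fin m}
    (hK : pattern K = pattern (rowsOf π)) : kOf π (sigmaOf π K) = K := by
  funext a j
  rw [kOf]
  set p := (sigmaOf π K j).symm a with hp
  have ha : sigmaOf π K j p = a := by rw [hp]; exact Equiv.apply_symm_apply _ _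
  rw [sigmaOf_apply hπ hK] at ha
  rw [← ha, kOf_invColAt (exists_of_pattern_eq hK j p)]
  rfl

/-- `sigmaOf ∘ kOf = id`. [cite: Kumar2015, Prop. 5.2 (proof)] -/
theorem sigmaOf_kOf {π : Fin i → Perm (Fin m)} (hπ : ColInj π) (σ : Fin m → Perm (Fin i)) :
    sigmaOf π (kOf π σ) = σ := by
  have hK : pattern (kOf π σ) = pattern (rowsOf π) := pattern_kOf π σ
  funext j
  refine Equiv.ext fun p => ?_
  rw [sigmaOf_apply hπ hK]
  have hex : ∃ a, kOf π σ a j = rowsOf π p j := ⟨σ j p, kOf_apply_sigma π σ p j⟩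
  have h1 := kOf_invColAt (π := π) hex
  set a := invColAt π (kOf π σ) j p
  rw [kOf, rowsOf] at h1
  have h2 : (σ j).symm a = p := hπ j h1
  have := congrArg (σ j) h2
  rw [Equiv.apply_symm_apply] at this
  exact this

/-- The permutations attached to a Latin rectangle with the right pattern are good.
[cite: Kumar2015, Prop. 5.2 (proof)] -/
theorem good_sigmaOf {π : Fin i → Perm (Fin m)} (hπ : ColInj π) {K : Fin i → Fin m → Fin m}
    (hKL : IsLatinRect K) (hK : pattern K = pattern (rowsOf π)) : Good (sigmaOf π K) π := by
  rw [good_iff_rows_kOf_injective, kOf_sigmaOf hπ hK]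
  exact fun a => (hKL.1 a).1

open Classical in
/-- **For a column-injective array the good `σ` contribute `ε_c(rowsOf π) · (♯L⁺_𝒜 − ♯L⁻_𝒜)`**,
`𝒜` the pattern of `rowsOf π` (Kumar: `∑_{μ : (σ,μ) ∈ R} ε(μ) V_{A(σ,μ)} = ε_c(A(σ)) ∑_{B ∈ L_{σ̂}} ε_c(B) V_B`).
[cite: Kumar2015, Prop. 5.2 (proof)] -/
theorem sum_sign_eq_of_colInj {π : Fin i → Perm (Fin m)} (hπ : ColInj π) :
    (∑ σ : Fin m → Perm (Fin i), if Good σ π then ((∏ j, Perm.sign (σ j) : ℤˣ) : ℤ) else 0) =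
      ((rectColSign (rowsOf π) : ℤˣ) : ℤ) * signedCount i m (pattern (rowsOf π)) := by
  rw [← Finset.sum_filter, signedCount, Finset.mul_sum]
  refine Finset.sum_nbij' (kOf π) (sigmaOf π) (fun σ hσ => ?_) (fun K hK => ?_) (fun σ _ => ?_)
    (fun K hK => ?_) (fun σ hσ => ?_)
  · rw [Finset.mem_filter] at hσ
    exact Finset.mem_filter.mpr ⟨Finset.mem_univ _, isLatinRect_kOf hπ hσ.2, pattern_kOf π σ⟩
  · rw [Finset.mem_filter] at hK
    exact Finset.mem_filter.mpr ⟨Finset.mem_univ _, good_sigmaOf hπ hK.2.1 hK.2.2⟩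
  · exact sigmaOf_kOf hπ σ
  · rw [Finset.mem_filter] at hK
    exact kOf_sigmaOf hπ hK.2.2
  · rw [Finset.mem_filter] at hσ
    rw [prod_sign_eq hπ hσ.2, Units.val_mul]

/-! #### The multilinear coefficient is a sum of squares (Kumar Prop. 5.2, Cor. 5.3) -/

/-- The inverse of `rowsOf` on Latin rectangles (junk `1` on rows that are not permutations).
[folklore] -/
noncomputable def permsOf (R : Fin i → Fin m → Fin m) : Fin i → Perm (Fin m) := fun p =>
  if h : Function.Bijective (R p) then (Equiv.ofBijective (R p) h).symm else 1

/-- `rowsOf ∘ permsOf = id` on Latin rectangles. [folklore] -/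
theorem rowsOf_permsOf {R : Fin i → Fin m → Fin m} (hR : IsLatinRect R) :
    rowsOf (permsOf R) = R := by
  funext p j
  rw [rowsOf, permsOf, dif_pos (hR.1 p), Equiv.symm_symm, Equiv.ofBijective_apply]

/-- `permsOf ∘ rowsOf = id`. [folklore] -/
theorem permsOf_rowsOf (π : Fin i → Perm (Fin m)) : permsOf (rowsOf π) = π := by
  funext p
  have hb : Function.Bijective (rowsOf π p) := (π p).symm.bijective
  rw [permsOf, dif_pos hb]
  refine Equiv.ext fun j => ?_
  rw [Equiv.symm_apply_eq, Equiv.ofBijective_apply, rowsOf, Equiv.symm_apply_apply]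

open Classical in
/-- **Kumar's Proposition 5.2 as a coefficient identity.** The coefficient of the multilinear
monomial `∏_{r,a} c_{r,a}` in the design polynomial is `∑_𝒜 (♯L⁺_𝒜 − ♯L⁻_𝒜)²`, the sum over all
patterns of size `(i,m)` of the squares of their signed Latin-rectangle counts (Kumar:
"`⟨v_o^{⊗i}, S(B_o)·𝔳_o^{⊗i}⟩ = (1/m!)^i ∑_{𝒜 ∈ S(i,m)} (♯L⁺_𝒜 − ♯L⁻_𝒜)²`"; the pairing there is this
coefficient up to the positive factor `(m!)^i`, cf. the module docstring). Proof as in print: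
cancellation off the Latin locus (`sum_sign_eq_zero_of_not_colInj`), the contribution
`ε_c(R) · S(pattern R)` of each Latin rectangle `R = rowsOf π` (`sum_sign_eq_of_colInj`), and
regrouping by pattern. [cite: Kumar2015, Prop. 5.2] -/
theorem coeff_allOnes_designPoly_eq_sum_sq (i m : ℕ) :
    coeff (allOnes i m) (designPoly i m) = ∑ A : Fin m → Finset (Fin m), signedCount i m A ^ 2 := by
  rw [coeff_allOnes_designPoly]
  -- only column-injective `π` contribute
  have h1 : ∀ π : Fin i → Perm (Fin m),
      (∑ σ : Fin m → Perm (Fin i), if Good σ π then ((∏ j, Perm.sign (σ j) : ℤˣ) : ℤ) else 0) =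
        if ColInj π then ((rectColSign (rowsOf π) : ℤˣ) : ℤ) * signedCount i m (pattern (rowsOf π))
        else 0 := by
    intro π
    split_ifs with hπ
    · exact sum_sign_eq_of_colInj hπ
    · exact sum_sign_eq_zero_of_not_colInj hπ
  rw [Finset.sum_congr rfl fun π _ => h1 π, ← Finset.sum_filter]
  -- reindex by Latin rectangles
  have h2 : ∑ π ∈ univ.filter (fun π : Fin i → Perm (Fin m) => ColInj π),
      ((rectColSign (rowsOf π) : ℤˣ) : ℤ) * signedCount i m (pattern (rowsOf π)) =
      ∑ R ∈ univ.filter (fun R : Fin i → Fin m → Fin m => IsLatinRect R),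
        ((rectColSign R : ℤˣ) : ℤ) * signedCount i m (pattern R) := by
    refine Finset.sum_nbij' rowsOf permsOf (fun π hπ => ?_) (fun R hR => ?_)
      (fun π _ => permsOf_rowsOf π) (fun R hR => ?_) (fun _ _ => rfl)
    · rw [Finset.mem_filter] at hπ
      exact Finset.mem_filter.mpr ⟨Finset.mem_univ _, isLatinRect_rowsOf hπ.2⟩
    · rw [Finset.mem_filter] at hR ⊢
      refine ⟨Finset.mem_univ _, fun j => ?_⟩
      have := hR.2.2 j
      rw [← rowsOf_permsOf hR.2] at this
      exact this
    · rw [Finset.mem_filter] at hR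
      exact rowsOf_permsOf hR.2
  rw [h2, ← Finset.sum_fiberwise_of_maps_to (t := (univ : Finset (Fin m → Finset (Fin m))))
    (g := pattern) (fun _ _ => Finset.mem_univ _)]
  refine Finset.sum_congr rfl fun A _ => ?_
  rw [Finset.filter_filter]
  have h3 : ∀ R ∈ univ.filter (fun R : Fin i → Fin m → Fin m => IsLatinRect R ∧ pattern R = A),
      ((rectColSign R : ℤˣ) : ℤ) * signedCount i m (pattern R) =
        ((rectColSign R : ℤˣ) : ℤ) * signedCount i m A :=
    fun R hR => by rw [(Finset.mem_filter.mp hR).2.2]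
  rw [Finset.sum_congr rfl h3, ← Finset.sum_mul, sq]
  rfl

/-- **The design polynomial is nonzero as soon as one pattern has a nonzero signed count** (its
multilinear coefficient is a sum of squares containing that square; Kumar Cor. 5.3 / Thm. 5.6,
first part). [cite: Kumar2015, Cor. 5.3 and Thm. 5.6] -/
theorem designPoly_ne_zero {A : Fin m → Finset (Fin m)} (hA : signedCount i m A ≠ 0) :
    designPoly i m ≠ 0 := by
  intro h
  have hc := coeff_allOnes_designPoly_eq_sum_sq i m
  rw [h, coeff_zero] at hc
  have hpos : 0 < ∑ A : Fin m → Finset (Fin m), signedCount i m A ^ 2 :=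
    lt_of_lt_of_le (pow_pos (abs_pos.mpr hA) 2 |>.trans_eq (sq_abs _))
      (Finset.single_le_sum (fun B _ => sq_nonneg (signedCount i m B)) (Finset.mem_univ A))
  exact hpos.ne hc

/-- **Kumar, Thm. 5.6 with Prop. 4.4, polynomial form.** A nonzero column-signed count of Latin
squares of order `m` (the column Latin square conjecture for `m`) forces the design polynomial of
every size `i ≤ m` to be nonzero. [cite: Kumar2015, Thm. 5.6 ("In particular")] -/
theorem designPoly_ne_zero_of_latinColCount_ne_zero (hm : latinColCount m ≠ 0) (hi : i ≤ m) :
    designPoly i m ≠ 0 := by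
  obtain ⟨A, hA⟩ := exists_signedCount_ne_zero hm hi
  exact designPoly_ne_zero hA

end Design

end Literature.Computability.AlgebraicComplexity.Kumar2015
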